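import Mathlib
import HarnessLib
import Summits.HubbardSuperconductivity.HubbardSuperconductivity.Theorems.KLProgrammeKLRegimeOverlapWtPairTelPiece
import Summits.HubbardSuperconductivity.HubbardSuperconductivity.Theorems.KLProgrammeKLRegimeOverlapWtMeanFreeBaseDoors
import Summits.HubbardSuperconductivity.HubbardSuperconductivity.Theorems.KLProgrammeKLRegimeEngineOverlapMeanFreeTelRegime

/-!
# K3 ENGINE child (stmt-HubbardSuperconductivity-20437), stub (b) (ℓ)/(I2), located item «(I2)-WT-WINDOW» (X1b): the OWN-RATE weighted neighbouring
# thin × thin character sum `Σ_z w_{k+1}(z)‖S_{F_{k+1}F_k[K♯_n]}(z)‖` AT THE FINAL MEAN-FREE FLOW FRAME `K♯_n = K_n ⊖ 0`, from a base index `m₀` — NO depth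
# window at `n` (W4 one level down: the telescope at the character-sum level)

Cell `gate-hubbard-kl`, seat p4 g17.  p3's base `charSumWt_klAnisoPair_nb_of_thresholds` at the mean-free base frame `K♯_{m₀}` (admissible with the bumped
package, `frameOK_meanFreeBase`; its order-three datum is that of `K_{m₀}`, so the level-`(k+1)` datum holds on the BASE window `4^{m₀}·U ≤ 4^{2(k+1)+d}`)
plus the telescope along the mean-free chain `K♯_i`, `m₀ ≤ i ≤ n`, with the per-piece brick `charSumWt_nbPair_sub_meanFree_ownRate` (…OverlapWtPairTelPiece):
`Σ_{i ≥ m₀} 4^{k+1}/4^i ≤ 4/3` (`sum_four_pow_div_le`) and `(n − m₀)·U² ≤ cc/log 4 ≤ 1` (`IsKLRegime`), exactly as in W4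
(`overlapWt_rows_cols_klEng_meanFreeFinal`):

* `sum_wt_norm_charSum_add_le` — two-term subadditivity of a weighted `ℓ¹` character-sum norm (from `sum_wt_norm_charSum_sum_le`);
* **`charSumWt_nbPair_klEng_meanFreeFinal (d) (R) (c″)`** — `∃ C_T > 0`: stub-(b) binders + `c″U ≤ 1`, `IsKLRegime U cc (−n)`, `HistP … 0 n`, the REGISTERED (K5′)
  clauses `∀ m, 1 ≤ m → m < n → FlowPieceOscAt … c″ … m`, a base index `1 ≤ m₀ ≤ n` with `2(k+1)+5 ≤ m₀` and `4^{m₀}·U ≤ 4^{2(k+1)+d}`: for every sector pair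
  `(ω, a′)` the `Λ_{k+1}`-rate weighted character sum of `F_{k+1,ω}[K♯_n]·F_{k,a′}[K♯_n]` is `≤ C_T·M·L²`
  (`C_T = C_T^{base}(d) + (c″+Gfr₁+Gfr₂+Gfr₃+1)(4Φ₁/3 + Φ₂)`-class; the `R, c″` dependence is the explicit factor of the x-free telescope part).

This is the `hT` input of p3's `overlapWt_jump_sums_le_of_nbWindow` at one level, window-free; the per-level case split and the jump assembly are
…OverlapWtJumpFlowAll (X2).  No definitions, no sorry.  Nothing asserts any stub, K3 or superconductivity.
[cite: BenfattoGiulianiMastropietro2006, §2.7 (2.71a), §2.8 (2.77), (2.82)–(2.83), §3 (3.2)–(3.8)]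
-/

noncomputable section

namespace Summit.HubbardSuperconductivity.HubbardSuperconductivity.Theorems.TorusFourierL2

set_option linter.dupNamespace false -- summit = problem name (single-conjunct summit), D-0017

open Set Finset Literature.MathematicalPhysics.QuantumLattice Literature.MathematicalPhysics.QuantumLattice.BandSectorCounting
open Literature.MathematicalPhysics.QuantumLattice.FermiRG Literature.Probability.LatticeModels Literature.Analysis.SpecialFunctions
open Summit.HubbardSuperconductivity.HubbardSuperconductivity.Theorems.DispersionFlow
open Summit.HubbardSuperconductivity.HubbardSuperconductivity.Theorems.KLRegimeSplit
open Summit.HubbardSuperconductivity.HubbardSuperconductivity.Theorems.KLProgrammeLegKernels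
open Summit.HubbardSuperconductivity.HubbardSuperconductivity.Theorems.PerturbedFermiCurve
open scoped Real Nat

open Classical

/-! ## §1 Two-term subadditivity of the weighted character-sum norm -/

/-- **Two summands**: the weighted `ℓ¹` norm of the character sum of `G₁ + G₂` is at most the sum of those of `G₁` and `G₂` (`w ≥ 0`). [folklore] -/
theorem sum_wt_norm_charSum_add_le {P V : ℕ} [NeZero P] [NeZero V] (w : TorusSite 1 P × TorusSite 2 V → ℝ) (hw : ∀ z, 0 ≤ w z)
    (G₁ G₂ : TorusSite 1 P × TorusSite 2 V → ℂ) :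
    ∑ z : TorusSite 1 P × TorusSite 2 V, w z * ‖∑ q : TorusSite 1 P × TorusSite 2 V, (torusChar q.1 z.1 * torusChar q.2 z.2) • (G₁ q + G₂ q)‖ ≤
      ∑ z : TorusSite 1 P × TorusSite 2 V, w z * ‖∑ q : TorusSite 1 P × TorusSite 2 V, (torusChar q.1 z.1 * torusChar q.2 z.2) • G₁ q‖ +
        ∑ z : TorusSite 1 P × TorusSite 2 V, w z * ‖∑ q : TorusSite 1 P × TorusSite 2 V, (torusChar q.1 z.1 * torusChar q.2 z.2) • G₂ q‖ := by
  have h := sum_wt_norm_charSum_sum_le (univ : Finset (Fin 2)) w hw ![G₁, G₂]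
  simpa [Fin.sum_univ_two] using h

/-- **Telescope**: `G (m₀ + d) = G m₀ + Σ_{j<d} (G (m₀+j+1) − G (m₀+j))` pointwise, for functions into an additive commutative group. [folklore] -/
theorem fun_eq_base_add_sum_range_sub {α β : Type*} [AddCommGroup β] (G : ℕ → α → β) (m₀ d : ℕ) (q : α) :
    G (m₀ + d) q = G m₀ q + ∑ j ∈ range d, (G (m₀ + j + 1) q - G (m₀ + j) q) := by
  have h := Finset.sum_range_sub (fun j => G (m₀ + j) q) d
  simp only [Nat.add_zero, ← add_assoc] at h
  rw [h]; abel

/-! ## §2 The own-rate neighbouring character sum at the final mean-free flow frame -/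

set_option maxHeartbeats 4000000 in
/-- **The `Λ_{k+1}`-rate weighted neighbouring thin × thin character sum at the final mean-free flow frame `K♯_n`** (see the module docstring): p3's base at
`K♯_{m₀}` plus the (X1a) pieces along the mean-free chain, `(n − m₀)U² ≤ 1` in the KL regime.
[cite: BenfattoGiulianiMastropietro2006, §2.7 (2.71a), §2.8 (2.77), (2.82)–(2.83), §3 (3.2)–(3.8)] -/
theorem charSumWt_nbPair_klEng_meanFreeFinal (dd : ℕ) (R : RenConsts) (c'' : ℝ) (hc'' : 0 ≤ c'') :
    ∃ CT : ℝ, 0 < CT ∧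
      ∀ (G : GeoConsts) (P : SplitConsts) (Q : EngConsts) (cc : ℝ), R.WF2 → 0 < cc → cc ≤ EngineV8.klEngC₃6 P R →
      ∀ μ ∈ klWindowC, ∀ U : ℝ, 0 < U → U ≤ min (EngineV8.klEngU₀3 P R cc) (1 / (R.Gfr 3 + 1)) → c'' * U ≤ 1 →
      ∀ β : ℝ, klBetaMin ≤ β → β ≤ Real.exp (cc / U ^ 2) →
      ∀ (L M : ℕ) [NeZero L] [NeZero M], EngineV8.klEngL₃ β U ≤ L → EngineV8.klEngM₃ β U L ≤ M →
      ∀ n : ℕ, n ≤ nScales β + 1 → IsKLRegime U cc (-(n : ℤ)) → HistP klPredsV17F2 L M G P Q R β U μ 0 n →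
        (∀ m, 1 ≤ m → m < n → FlowPieceOscAt L M c'' β U μ m) →
        ∀ m₀ : ℕ, 1 ≤ m₀ → m₀ ≤ n → ∀ k : ℕ, 2 * (k + 1) + 5 ≤ m₀ → (4 : ℝ) ^ m₀ * U ≤ (4 : ℝ) ^ (2 * (k + 1) + dd) →
        ∀ (ω : Fin (sectorCount (k + 1))) (a' : Fin (sectorCount k)),
        ∑ z : TorusSite 1 (2 * M) × TorusSite 2 L,
          (1 + klScale klE0 (k + 1) * β / (2 * M) * |(((z.1 0).valMinAbs : ℤ) : ℝ)| + klScale klE0 (k + 1) * |(((z.2 0).valMinAbs : ℤ) : ℝ)| +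
              klScale klE0 (k + 1) * |(((z.2 1).valMinAbs : ℤ) : ℝ)|) *
          ‖∑ q : TorusSite 1 (2 * M) × TorusSite 2 L, (torusChar q.1 z.1 * torusChar q.2 z.2) •
            (klAnisoFamily L M β μ (fsub (klFlowFrameU L M β U μ n) (symInterp L fun _ =>
                ∑ m ∈ Ico n n, klAngularMean (klLocalPart L M β U μ (klFlowFrameU L M β U μ m) m))) klE0 (k + 1) ω (⟨(q.1 0).val, ZMod.val_lt (q.1 0)⟩, q.2) *
              klAnisoFamily L M β μ (fsub (klFlowFrameU L M β U μ n) (symInterp L fun _ =>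
                ∑ m ∈ Ico n n, klAngularMean (klLocalPart L M β U μ (klFlowFrameU L M β U μ m) m))) klE0 k a' (⟨(q.1 0).val, ZMod.val_lt (q.1 0)⟩, q.2))‖ ≤
          CT * M * (L : ℝ) ^ 2 := by
  have ha : (-4 : ℝ) < -(6 / 5) := by norm_num
  have hab : (-(6 / 5) : ℝ) ≤ -(1 / 10) := by norm_num
  have hb : (-(1 / 10) : ℝ) < 0 := by norm_num
  have he : (0 : ℝ) < klE0 := by norm_num [klE0]
  obtain ⟨CTb, hCTb, hbase⟩ := charSumWt_klAnisoPair_nb_of_thresholds ha hab hb ((4 : ℝ) ^ dd / 3072)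
  obtain ⟨Φ₁, Φ₂, hΦ₁, hΦ₂, hpiece⟩ := charSumWt_nbPair_sub_meanFree_ownRate
  set Γ : ℝ := |c''| + |R.Gfr 1| + |R.Gfr 2| + |R.Gfr 3| + 1 with hΓ
  have hΓ0 : 0 < Γ := by rw [hΓ]; positivity
  refine ⟨CTb + Γ * (4 * Φ₁ / 3 + Φ₂), by positivity, ?_⟩
  intro G P Q cc hR2 hcc hcc6 μ hμ U hU hUle hcU β hβmin hβc L M _ _ hL3 hM3 n hnN hreg hhist hosc m₀ hm1 hmn k hkm hwin ω a'
  have hRj : ∀ j, 0 ≤ R.Gfr j := EngineV8.gfr_nonneg_of_wf2 hR2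
  have hcr : 0 ≤ R.cr := hR2.1.1
  have hβ0 : 0 < β := pos_of_klBetaMin_le hβmin
  have hL0 : (0 : ℝ) < L := Nat.cast_pos.2 (Nat.pos_of_ne_zero (NeZero.ne L))
  have hM0 : (0 : ℝ) < M := Nat.cast_pos.2 (Nat.pos_of_ne_zero (NeZero.ne M))
  have hΓeq : Γ = c'' + R.Gfr 1 + R.Gfr 2 + R.Gfr 3 + 1 := by
    rw [hΓ, abs_of_nonneg hc'', abs_of_nonneg (hRj 1), abs_of_nonneg (hRj 2), abs_of_nonneg (hRj 3)]
  -- doors: `U ≤ 1`, `cc ≤ 1`, hence `G₀ ≤ Γ` and `(n − m₀)U² ≤ 1`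
  have hcle := (hcc6.trans (EngineV8.klEngC₃6_le_klEngC₃3 P R)).trans (EngineV8.klEngC₃3_le_symbolC₃ ha hab hb P hRj)
  have hcc1 : cc ≤ 1 := by
    refine hcle.trans ?_
    have hG2 : 0 < 12 * (R.Gfr 2 + 1) := by have := hRj 2; positivity
    rw [div_le_one hG2]
    have hk : min (min ((bandBounds ha hab hb).Dtmin / 4) ((bandBounds ha hab hb).rhomin / 4)) (1 / 40) ≤ 1 / 40 := min_le_right _ _
    nlinarith [hk, hRj 2]
  have hU3 : U ≤ EngineV8.klEngU₀3 P R cc := hUle.trans (min_le_left _ _)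
  have hUG' : U ≤ 1 / (R.Gfr 3 + 1) := hUle.trans (min_le_right _ _)
  have hU1 : U ≤ 1 := (hU3.trans (EngineV8.klEngU₀3_le_symbolU₀ ha hab hb P hRj cc)).trans (min_le_left _ _)
  have hlog : 1 ≤ Real.log 4 := by
    have h4 : Real.exp 1 ≤ 4 := by have := Real.exp_one_lt_d9; norm_num at this; linarith
    calc (1 : ℝ) = Real.log (Real.exp 1) := (Real.log_exp 1).symm
      _ ≤ Real.log 4 := Real.log_le_log (Real.exp_pos 1) h4
  have hdnU : ((n - m₀ : ℕ) : ℝ) * U ^ 2 ≤ 1 := by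
    have hr : U ^ 2 * |((-(n : ℤ) : ℤ) : ℝ)| * Real.log 4 ≤ cc := hreg
    rw [show |((-(n : ℤ) : ℤ) : ℝ)| = (n : ℝ) by push_cast; rw [abs_neg]; exact abs_of_nonneg (Nat.cast_nonneg n)] at hr
    have hdn : ((n - m₀ : ℕ) : ℝ) ≤ (n : ℝ) := by exact_mod_cast Nat.sub_le n m₀
    have h1 : (n : ℝ) * U ^ 2 ≤ (n : ℝ) * U ^ 2 * Real.log 4 := le_mul_of_one_le_right (by positivity) hlog
    nlinarith [hdn, h1, hr, hcc1, sq_nonneg U]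
  set G₀ : ℝ := (c'' + R.Gfr 1 + R.Gfr 2 + R.Gfr 3 + 1) * U ^ 2 with hG₀def
  have hG₀Γ : G₀ = Γ * U ^ 2 := by rw [hG₀def, hΓeq]
  have hG₀0 : 0 ≤ G₀ := by rw [hG₀Γ]; positivity
  have hU21 : U ^ 2 ≤ 1 := by nlinarith only [hU, hU1]
  have hG₀le : G₀ ≤ Γ := by rw [hG₀Γ]; nlinarith only [hΓ0, hU21]
  have hdG₀ : ((n - m₀ : ℕ) : ℝ) * G₀ ≤ Γ := by
    rw [hG₀Γ]
    calc ((n - m₀ : ℕ) : ℝ) * (Γ * U ^ 2) = Γ * (((n - m₀ : ℕ) : ℝ) * U ^ 2) := by ring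
      _ ≤ Γ * 1 := mul_le_mul_of_nonneg_left hdnU hΓ0.le
      _ = Γ := mul_one _
  -- the base frame `K♯_{m₀}`, admissible with the bumped package; its order-three datum is that of `K_{m₀}`
  set Rb : RenConsts := ⟨R.cr, R.cz, fun i => if i = 0 then R.Gfr 0 + R.cr * klE0 else R.Gfr i⟩ with hRb
  have hRb0 : Rb.Gfr 0 = R.Gfr 0 + R.cr * klE0 := by simp [hRb]
  have hRbj : ∀ i, i ≠ 0 → Rb.Gfr i = R.Gfr i := fun i hi => by simp [hRb, hi]
  have hRbnn : ∀ i, 0 ≤ Rb.Gfr i := by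
    intro i
    by_cases hi : i = 0
    · subst hi; rw [hRb0]; have := hRj 0; positivity
    · rw [hRbj i hi]; exact hRj i
  have hcleb : cc ≤ min (min ((bandBounds ha hab hb).Dtmin / 4) ((bandBounds ha hab hb).rhomin / 4)) (1 / 40) / (12 * (Rb.Gfr 2 + 1)) := by
    rw [hRbj 2 two_ne_zero]; exact hcle
  have hcc480 : cc ≤ 1 / (480 * (R.Gfr 2 + 1)) := by
    refine hcle.trans ?_
    have hG2 : 0 < 12 * (R.Gfr 2 + 1) := by have := hRj 2; positivity
    rw [div_le_div_iff₀ hG2 (by have := hRj 2; positivity)]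
    have hk : min (min ((bandBounds ha hab hb).Dtmin / 4) ((bandBounds ha hab hb).rhomin / 4)) (1 / 40) ≤ 1 / 40 := min_le_right _ _
    nlinarith [hk, hRj 2]
  have hUd : U ≤ 1 / (2 ^ 12 * (R.Gfr 0 + R.Gfr 1 + R.cr + 1)) := hU3.trans (klEngU₀3_le_inv_baseDoor P (hRj 0) (hRj 1) hcr cc)
  have hGU : R.Gfr 3 * U ≤ 1 := by
    have hG3 := hRj 3
    calc R.Gfr 3 * U ≤ R.Gfr 3 * (1 / (R.Gfr 3 + 1)) := mul_le_mul_of_nonneg_left hUG' hG3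
      _ = R.Gfr 3 / (R.Gfr 3 + 1) := by ring
      _ ≤ 1 := by rw [div_le_one (by positivity)]; linarith only [hG3]
  have hU3b : U ≤ min 1 (min (min ((bandBounds ha hab hb).Dtmin / 4) ((bandBounds ha hab hb).rhomin / 4)) (1 / 40) /
      (24 * (Rb.Gfr 0 + Rb.Gfr 1 + 1))) := by
    rw [hRb0, hRbj 1 one_ne_zero, EngineV8.symbolKappa_eq ha hab hb]
    exact hU3.trans (klEngU₀3_le_min_div_bumped P (hRj 0) (hRj 1) hcr cc)
  have hLβ : β ^ 2 ≤ (L : ℝ) := EngineV8.sq_le_of_klEngL₃_le hL3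
  have hMβ : β ≤ (M : ℝ) := EngineV8.le_of_klEngM₃_le hβmin hL3 hM3
  -- the chain frames and the pair symbols along the chain
  set Kc : ℕ → TrigPolyC4v := fun i => fsub (klFlowFrameU L M β U μ i) (symInterp L fun _ =>
    ∑ m ∈ Ico i n, klAngularMean (klLocalPart L M β U μ (klFlowFrameU L M β U μ m) m)) with hKc
  set Gc : ℕ → TorusSite 1 (2 * M) × TorusSite 2 L → ℂ := fun i q =>
    klAnisoFamily L M β μ (Kc i) klE0 (k + 1) ω (⟨(q.1 0).val, ZMod.val_lt (q.1 0)⟩, q.2) *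
      klAnisoFamily L M β μ (Kc i) klE0 k a' (⟨(q.1 0).val, ZMod.val_lt (q.1 0)⟩, q.2) with hGc
  set w : TorusSite 1 (2 * M) × TorusSite 2 L → ℝ := fun z =>
    1 + klScale klE0 (k + 1) * β / (2 * M) * |(((z.1 0).valMinAbs : ℤ) : ℝ)| + klScale klE0 (k + 1) * |(((z.2 0).valMinAbs : ℤ) : ℝ)| +
      klScale klE0 (k + 1) * |(((z.2 1).valMinAbs : ℤ) : ℝ)| with hwdef
  have hw0 : ∀ z, 0 ≤ w z := by
    intro z; rw [hwdef]; dsimp only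
    have := (klth_klScale_pos (k + 1)).le; positivity
  -- the base at `K♯_{m₀}`
  have hfr : FrameOK Rb U (nScales β) μ (Kc m₀) := frameOK_meanFreeBase hR2 hμ hU hU1 hUd hcc.le hcc480 hreg hm1 hmn hnN hhist
  obtain ⟨N, rfl⟩ : ∃ N, m₀ = N + 1 := ⟨m₀ - 1, by omega⟩
  have hh := (histP_klPredsV17F2_iff L M G P Q R β U μ 0 n).1 hhist
  have hJets : ∀ m ≤ N, FlowPieceJetsAt L M β U μ R m := fun m hm => (hh m (by omega)).2.1.2.1
  have hGeo : FlowGeometryAt L M β U μ N := (hh N (by omega)).2.1.2.2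
  have hK1 : FrameOK R U N μ (klFlowFrameU L M β U μ (N + 1)) := frameOK_klFlowFrameU_succ hJets hGeo
  have hA3 : ∀ p : Momentum, ‖iteratedFDeriv ℝ 3 (frameShift (Kc (N + 1))) p‖ ≤ R.Gfr 3 * U ^ 2 * ((4 : ℝ) ^ (N + 1) / 3) := by
    intro p
    rw [hKc]; dsimp only
    rw [iteratedFDeriv_frameShift_fsub_symInterp_const _ _ (by norm_num)]
    exact (frameShift_high_sizes_of_frameOK hRj hK1).1 p
  have hdat : R.Gfr 3 * U ^ 2 * ((4 : ℝ) ^ (N + 1) / 3) * klScale klE0 (k + 1) ^ 2 ≤ (4 : ℝ) ^ dd / 3072 :=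
    frameDatumAt_le_of_pow_window hU.le hGU le_rfl hwin
  have hbase0 : ∑ z : TorusSite 1 (2 * M) × TorusSite 2 L, w z *
      ‖∑ q : TorusSite 1 (2 * M) × TorusSite 2 L, (torusChar q.1 z.1 * torusChar q.2 z.2) • Gc (N + 1) q‖ ≤ CTb * M * (L : ℝ) ^ 2 := by
    have hbd := hbase Rb hRbnn cc U hcc hcleb hU hU3b β hβmin hβc μ hμ (Kc (N + 1)) hfr (R.Gfr 3 * U ^ 2 * ((4 : ℝ) ^ (N + 1) / 3)) hA3 L M hLβ hMβ
      (k + 1) (by omega) (by omega) hdat ω a'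
    simp only [hwdef, hGc]
    exact hbd
  -- the pieces along the chain
  have hstep : ∀ j < n - (N + 1), ∑ z : TorusSite 1 (2 * M) × TorusSite 2 L, w z *
      ‖∑ q : TorusSite 1 (2 * M) × TorusSite 2 L, (torusChar q.1 z.1 * torusChar q.2 z.2) • (Gc (N + 1 + j + 1) q - Gc (N + 1 + j) q)‖ ≤
      M * (L : ℝ) ^ 2 * ((Φ₁ * (4 : ℝ) ^ (k + 1) / (4 : ℝ) ^ (N + 1 + j) + Φ₂) * G₀) := by
    intro j hj
    have h := hpiece G P R Q cc hR2 hcc hcc6 μ hμ U hU hUle c'' hc'' hcU β hβmin hβc L M hL3 hM3 n hnN hreg hhist hosc L hL3 k (N + 1 + j)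
      (by omega) (by omega) ω a'
    simpa only [hGc, hKc, hwdef, hG₀def, mul_sub] using h
  -- the telescope
  have htel : ∀ q, Gc n q = Gc (N + 1) q + ∑ j ∈ range (n - (N + 1)), (Gc (N + 1 + j + 1) q - Gc (N + 1 + j) q) := by
    intro q
    have h := fun_eq_base_add_sum_range_sub Gc (N + 1) (n - (N + 1)) q
    rwa [show N + 1 + (n - (N + 1)) = n by omega] at h
  have hsum : ∑ j ∈ range (n - (N + 1)), M * (L : ℝ) ^ 2 * ((Φ₁ * (4 : ℝ) ^ (k + 1) / (4 : ℝ) ^ (N + 1 + j) + Φ₂) * G₀) ≤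
      M * (L : ℝ) ^ 2 * (Γ * (4 * Φ₁ / 3 + Φ₂)) := by
    rw [← Finset.mul_sum]
    refine mul_le_mul_of_nonneg_left ?_ (by positivity)
    have e1 : ∑ j ∈ range (n - (N + 1)), (Φ₁ * (4 : ℝ) ^ (k + 1) / (4 : ℝ) ^ (N + 1 + j) + Φ₂) * G₀ =
        ∑ j ∈ range (n - (N + 1)), (Φ₁ * G₀ * ((4 : ℝ) ^ (k + 1) / (4 : ℝ) ^ (N + 1 + j)) + Φ₂ * G₀) := Finset.sum_congr rfl fun j _ => by ring
    rw [e1, Finset.sum_add_distrib, ← Finset.mul_sum, Finset.sum_const, Finset.card_range, nsmul_eq_mul]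
    have hs := sum_four_pow_div_le (show k + 1 ≤ N + 1 by omega) (n - (N + 1))
    have t1 : Φ₁ * G₀ * ∑ j ∈ range (n - (N + 1)), (4 : ℝ) ^ (k + 1) / (4 : ℝ) ^ (N + 1 + j) ≤ Φ₁ * G₀ * (4 / 3) :=
      mul_le_mul_of_nonneg_left hs (by positivity)
    have t2 : Φ₁ * G₀ * (4 / 3) ≤ Φ₁ * Γ * (4 / 3) := by nlinarith only [hG₀le, hΦ₁]
    have t3 : ((n - (N + 1) : ℕ) : ℝ) * (Φ₂ * G₀) = Φ₂ * (((n - (N + 1) : ℕ) : ℝ) * G₀) := by ring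
    have t4 : Φ₂ * (((n - (N + 1) : ℕ) : ℝ) * G₀) ≤ Φ₂ * Γ := mul_le_mul_of_nonneg_left hdG₀ hΦ₂.le
    nlinarith only [t1, t2, t3, t4]
  -- assemble
  have hfin : ∑ z : TorusSite 1 (2 * M) × TorusSite 2 L, w z *
      ‖∑ q : TorusSite 1 (2 * M) × TorusSite 2 L, (torusChar q.1 z.1 * torusChar q.2 z.2) • Gc n q‖ ≤ (CTb + Γ * (4 * Φ₁ / 3 + Φ₂)) * M * (L : ℝ) ^ 2 := by
    have e : (fun q => Gc n q) = fun q => Gc (N + 1) q + ∑ j ∈ range (n - (N + 1)), (Gc (N + 1 + j + 1) q - Gc (N + 1 + j) q) := funext htel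
    calc _ = ∑ z : TorusSite 1 (2 * M) × TorusSite 2 L, w z * ‖∑ q : TorusSite 1 (2 * M) × TorusSite 2 L, (torusChar q.1 z.1 * torusChar q.2 z.2) •
          (Gc (N + 1) q + ∑ j ∈ range (n - (N + 1)), (Gc (N + 1 + j + 1) q - Gc (N + 1 + j) q))‖ := by
            simp_rw [← htel]
      _ ≤ _ := sum_wt_norm_charSum_add_le w hw0 _ _
      _ ≤ CTb * M * (L : ℝ) ^ 2 + ∑ j ∈ range (n - (N + 1)), M * (L : ℝ) ^ 2 * ((Φ₁ * (4 : ℝ) ^ (k + 1) / (4 : ℝ) ^ (N + 1 + j) + Φ₂) * G₀) := by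
            refine add_le_add hbase0 ((sum_wt_norm_charSum_sum_le (range (n - (N + 1))) w hw0
              (fun j q => Gc (N + 1 + j + 1) q - Gc (N + 1 + j) q)).trans (Finset.sum_le_sum fun j hj => hstep j (mem_range.1 hj)))
      _ ≤ CTb * M * (L : ℝ) ^ 2 + M * (L : ℝ) ^ 2 * (Γ * (4 * Φ₁ / 3 + Φ₂)) := add_le_add le_rfl hsum
      _ = (CTb + Γ * (4 * Φ₁ / 3 + Φ₂)) * M * (L : ℝ) ^ 2 := by ring
  simpa only [hwdef, hGc, hKc] using hfin

end Summit.HubbardSuperconductivity.HubbardSuperconductivity.Theorems.TorusFourierL2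

end
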